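import Summits.BirchSwinnertonDyer.BirchSwinnertonDyer.Theorems.RamifiedSevenEllipticUnitsLemmaXiFrame
import Summits.BirchSwinnertonDyer.BirchSwinnertonDyer.Theorems.RamifiedSevenEllipticUnitsLemmaXiValuePairs
import Summits.BirchSwinnertonDyer.Rank1Residual.X12.O11.RamifiedRubinPackageReducedLineZp
import Summits.BirchSwinnertonDyer.Rank1Residual.X12.CMNoPrimeTorsion
import HarnessLib

set_option linter.dupNamespace false
set_option autoImplicit false

/-!
# Lemma Ξ, kernel side (X): the registered stub H_V `stub_acCharacterValuesSeven`
# (`X12.O11.RamifiedCMAcCharacterValuesAtZp W p`) REDUCED to H_Rig + Deuring's value clause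

Helper file for the K7r Value crux `EllipticUnitValueSevenOfGZK` (stmt-BirchSwinnertonDyer-19945), line
`rubin-formula-zp` v4.1 (skeleton 8612b7bbe22dc698), registered stubs H_V `stub_acCharacterValuesSeven` and
H_Rig `stub_pinnedCharacterStructureSeven` (both assigned to base k7r-c2). H_V asks, for every Hecke
character `ψ` of infinity type `(1,0)`, conjugation-equivariant and L-pinned to a CM curve `V` of the frame's
CM field, and every `φ ∈ {ψ, ψ∘cK}`: (all) off a finite set, `v ∤ p`, `φ(φ∘cK)⁻¹` unramified at `v` and
`‖ι⁻¹(φ_ac(ϖ_v)) − 1‖² ≤ p⁻¹`; (one) some such `v` with equality. This file proves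

* `LemmaXi.φac_values_of_deuringShape` — (all) ∧ (one) for a conjugation-equivariant `φ` with DEURING-SHAPED
  values (`φ(ϖ_w) = σ'(α_w)`, `(α_w) = w` off a finite set) in frame currency (`IsImaginaryQuadratic K`,
  `discr K = −p`, `5 ≤ p`, `𝔭 ∋ p`, `c ≠ 1`) — files (III), (VI) (Landau), (VIII);
* `LemmaXi.φac_values_galConj` — (all) ∧ (one) pass from `φ` to `φ∘c` (`c² = 1`: the values invert, and
  `‖y⁻¹ − 1‖ = ‖y − 1‖` for principal units);
* `acCharacterValuesAtZp_of_pinnedStructure_of_deuringShape` — **H_V from H_Rig and the Deuring value clause**: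
  `X12.O11.RamifiedCMPinnedCharacterStructureAtZp W p` (uniqueness of the pinned character up to `cK`) and,
  for every CM curve `V` of the frame's CM field, the EXISTENCE of a conjugation-equivariant character pinned to
  `V` whose values at unramified places are embedded generators (Silverman ATAEC II Thm. 9.2 + Cor. 10.4.1 (a)
  — the printed Deuring theorem; cell typing ask W50 adds exactly this clause (vi) to the tree's
  `Deuring_exists_heckeCharacter_of_maximalCM`) ⟹ `X12.O11.RamifiedCMAcCharacterValuesAtZp W p`.

So H_V carries NO content beyond H_Rig and print: once W50 lands, `stub_acCharacterValuesSeven` closes by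
`acCharacterValuesAtZp_of_pinnedStructure_of_deuringShape W 7 (stub_pinnedCharacterStructureSeven …) (Deuring)`.

References: Silverman, *Advanced Topics*, II Thm. 9.2, Cor. 10.4.1; Landau 1918 §1; [BKNO] arXiv:2608.06879
Def. 4.2.
-/

noncomputable section

open scoped Classical NNReal Topology Pointwise ComplexConjugate
open NumberField IsDedekindDomain Field
  Literature.NumberTheory.EllipticCurves
  Literature.NumberTheory.EllipticCurves.BurungaleKobayashiNakamuraOta2026
  Literature.NumberTheory.GaloisRepresentations
  Literature.NumberTheory.QuadraticFields

namespace Summit.BirchSwinnertonDyer.BirchSwinnertonDyer.Theorems.RamifiedSevenEllipticUnits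

namespace LemmaXi

variable {K : Type} [Field K] [NumberField K] {p : ℕ} [hp : Fact p.Prime]

/-- **(all) ∧ (one) for a conjugation-equivariant character with Deuring-shaped values**, frame currency:
`K` imaginary quadratic, `discr K = −p`, `p ≥ 5`, `𝔭 ∋ p`, `c ≠ 1`, any `ι`, any `σ' : K →+* ℂ`. Off the
exceptional set (the given finite set and the places above `p`) every value `ι⁻¹(φ_ac(ϖ_v))` is within
`p^{−1/2}` of `1` (file (III)), and Landau's theorem (file (VI)) supplies a principal prime off the set where
the bound is attained. [cite: SilvermanATAEC1994, Ch. II Thm. 9.2 and Cor. 10.4.1 (a)] [cite: Landau1918Idealklassen, §1 Satz] -/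
theorem φac_values_of_deuringShape (hK : IsImaginaryQuadratic K) (hd : NumberField.discr K = -(p : ℤ))
    (hp5 : 5 ≤ p) {𝔭 : HeightOneSpectrum (𝓞 K)} (hp𝔭 : ((p : ℕ) : 𝓞 K) ∈ 𝔭.asIdeal)
    (c : K ≃ₐ[ℚ] K) (hc : c ≠ 1) (ι : PadicAlgCl p ≃+* ℂ) (σ' : K →+* ℂ) {φ : HeckeCharacter K}
    (heq : IsHeckeConjEquivariant c φ)
    (hvals : ∃ S : Set (HeightOneSpectrum (𝓞 K)), S.Finite ∧ ∀ w ∉ S,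
      φ.IsUnramifiedAt w ∧ ∃ α : 𝓞 K, Ideal.span {α} = w.asIdeal ∧ φ.valueAtUniformizer w = σ' (α : K)) :
    (∃ S : Set (HeightOneSpectrum (𝓞 K)), S.Finite ∧ ∀ v ∉ S,
      ((p : ℕ) : 𝓞 K) ∉ v.asIdeal ∧ (φ * (HeckeCharacter.galConj c φ)⁻¹).IsUnramifiedAt v ∧
        ‖((ι.symm ((φ * (HeckeCharacter.galConj c φ)⁻¹).valueAtUniformizer v) : PadicAlgCl p) :
          ℂ_[p]) - 1‖ ^ 2 ≤ ((p : ℝ))⁻¹) ∧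
    (∃ v : HeightOneSpectrum (𝓞 K), ((p : ℕ) : 𝓞 K) ∉ v.asIdeal ∧
      (φ * (HeckeCharacter.galConj c φ)⁻¹).IsUnramifiedAt v ∧
        ‖((ι.symm ((φ * (HeckeCharacter.galConj c φ)⁻¹).valueAtUniformizer v) : PadicAlgCl p) :
          ℂ_[p]) - 1‖ ^ 2 = ((p : ℝ))⁻¹) := by
  obtain ⟨h2, hdvd, hunits, ⟨θ, hθ⟩, hnr, hp2⟩ := frame_fieldInputs (K := K) hK hd hp5
  have hσ' : ∀ x : K, conj (σ' x) = σ' (c x) := conj_embedding_eq_embedding_algEquiv h2 c hc σ' (hnr σ')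
  obtain ⟨S, hS, hS'⟩ := hvals
  set S' : Set (HeightOneSpectrum (𝓞 K)) := S ∪ {v | ((p : ℕ) : 𝓞 K) ∈ v.asIdeal} with hS'def
  have hS'fin : S'.Finite := hS.union (finite_setOf_natCast_mem (K := K) p)
  let τ : K →+* PadicAlgCl p := ι.symm.toRingHom.comp σ'
  have hall : ∀ w ∉ S', ((p : ℕ) : 𝓞 K) ∉ w.asIdeal ∧
      (φ * (HeckeCharacter.galConj c φ)⁻¹).IsUnramifiedAt w ∧
      ‖((ι.symm ((φ * (HeckeCharacter.galConj c φ)⁻¹).valueAtUniformizer w) : PadicAlgCl p) :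
        ℂ_[p]) - 1‖ ^ 2 ≤ ((p : ℝ))⁻¹ := by
    intro w hw
    rw [hS'def, Set.mem_union, not_or] at hw
    obtain ⟨hwS, hpw⟩ := hw
    simp only [Set.mem_setOf_eq] at hpw
    obtain ⟨hunr, α, hαw, hφw⟩ := hS' w hwS
    refine ⟨hpw, hunr.mul' ((heq.isUnramifiedAt_galConj_iff' w).mpr hunr).inv', ?_⟩
    rw [symm_φac_valueAtUniformizer_eq_of_conjEquivariant c ι σ' hσ' heq hφw]
    exact norm_embedding_div_smul_sub_one_sq_le h2 hdvd 𝔭 hp𝔭 c τ (not_mem_of_span_eq hp𝔭 hpw hαw)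
  refine ⟨⟨S', hS'fin, hall⟩, ?_⟩
  obtain ⟨w₀, hw₀S', hpw₀, x, hw₀x, hx, hxnorm⟩ :=
    exists_goodPlace_of_sq_eq_neg h2 hdvd 𝔭 hp𝔭 hp2 c hc τ hθ S' hS'fin
  have hw₀S : w₀ ∉ S := fun h ↦ hw₀S' (Set.mem_union_left _ h)
  obtain ⟨hunr₀, α₀, hα₀w, hφw₀⟩ := hS' w₀ hw₀S
  refine ⟨w₀, hpw₀, hunr₀.mul' ((heq.isUnramifiedAt_galConj_iff' w₀).mpr hunr₀).inv', ?_⟩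
  rw [symm_φac_valueAtUniformizer_eq_of_conjEquivariant c ι σ' hσ' heq hφw₀,
    div_smul_eq_of_span_eq c hunits (hα₀w.trans hw₀x)]
  exact hxnorm

/-- In a quadratic field `c² = 1`, so `(φ∘c)∘c = φ`. [folklore] -/
theorem galConj_galConj_of_finrank_eq_two (h2 : Module.finrank ℚ K = 2) (c : K ≃ₐ[ℚ] K)
    (φ : HeckeCharacter K) : HeckeCharacter.galConj c (HeckeCharacter.galConj c φ) = φ := by
  have hcc : c * c = 1 := by
    ext x
    rw [AlgEquiv.mul_apply, algEquiv_apply_apply_of_finrank_eq_two h2 c x, AlgEquiv.one_apply]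
  rw [HeckeCharacter.galConj_galConj, hcc, HeckeCharacter.galConj_one]

/-- **(all) ∧ (one) pass from `φ` to `φ ∘ c`**: `(φ∘c)((φ∘c)∘c)⁻¹ = (φ(φ∘c)⁻¹)⁻¹`, the values invert, and
`‖y⁻¹ − 1‖ = ‖y − 1‖` for a principal unit `y`. [folklore] -/
theorem φac_values_galConj (h2 : Module.finrank ℚ K = 2)
    (c : K ≃ₐ[ℚ] K) (ι : PadicAlgCl p ≃+* ℂ) {φ : HeckeCharacter K}
    (h : (∃ S : Set (HeightOneSpectrum (𝓞 K)), S.Finite ∧ ∀ v ∉ S,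
        ((p : ℕ) : 𝓞 K) ∉ v.asIdeal ∧ (φ * (HeckeCharacter.galConj c φ)⁻¹).IsUnramifiedAt v ∧
          ‖((ι.symm ((φ * (HeckeCharacter.galConj c φ)⁻¹).valueAtUniformizer v) : PadicAlgCl p) :
            ℂ_[p]) - 1‖ ^ 2 ≤ ((p : ℝ))⁻¹) ∧
      (∃ v : HeightOneSpectrum (𝓞 K), ((p : ℕ) : 𝓞 K) ∉ v.asIdeal ∧
        (φ * (HeckeCharacter.galConj c φ)⁻¹).IsUnramifiedAt v ∧
          ‖((ι.symm ((φ * (HeckeCharacter.galConj c φ)⁻¹).valueAtUniformizer v) : PadicAlgCl p) :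
            ℂ_[p]) - 1‖ ^ 2 = ((p : ℝ))⁻¹)) :
    (∃ S : Set (HeightOneSpectrum (𝓞 K)), S.Finite ∧ ∀ v ∉ S,
        ((p : ℕ) : 𝓞 K) ∉ v.asIdeal ∧
          (HeckeCharacter.galConj c φ * (HeckeCharacter.galConj c (HeckeCharacter.galConj c φ))⁻¹).IsUnramifiedAt v ∧
          ‖((ι.symm ((HeckeCharacter.galConj c φ *
              (HeckeCharacter.galConj c (HeckeCharacter.galConj c φ))⁻¹).valueAtUniformizer v) : PadicAlgCl p) :
            ℂ_[p]) - 1‖ ^ 2 ≤ ((p : ℝ))⁻¹) ∧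
      (∃ v : HeightOneSpectrum (𝓞 K), ((p : ℕ) : 𝓞 K) ∉ v.asIdeal ∧
        (HeckeCharacter.galConj c φ * (HeckeCharacter.galConj c (HeckeCharacter.galConj c φ))⁻¹).IsUnramifiedAt v ∧
          ‖((ι.symm ((HeckeCharacter.galConj c φ *
              (HeckeCharacter.galConj c (HeckeCharacter.galConj c φ))⁻¹).valueAtUniformizer v) : PadicAlgCl p) :
            ℂ_[p]) - 1‖ ^ 2 = ((p : ℝ))⁻¹) := by
  have hp1 : ((p : ℝ))⁻¹ < 1 := inv_lt_one_of_one_lt₀ (by exact_mod_cast hp.out.one_lt)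
  -- `(φ∘c)((φ∘c)∘c)⁻¹ = (φ(φ∘c)⁻¹)⁻¹`
  have hinv : HeckeCharacter.galConj c φ * (HeckeCharacter.galConj c (HeckeCharacter.galConj c φ))⁻¹ =
      (φ * (HeckeCharacter.galConj c φ)⁻¹)⁻¹ := by
    rw [galConj_galConj_of_finrank_eq_two h2, mul_inv_rev, inv_inv]
  -- the value transfer at one place
  have key : ∀ v : HeightOneSpectrum (𝓞 K),
      (φ * (HeckeCharacter.galConj c φ)⁻¹).IsUnramifiedAt v →
      ‖((ι.symm ((φ * (HeckeCharacter.galConj c φ)⁻¹).valueAtUniformizer v) : PadicAlgCl p) :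
        ℂ_[p]) - 1‖ ^ 2 ≤ ((p : ℝ))⁻¹ →
      (HeckeCharacter.galConj c φ * (HeckeCharacter.galConj c (HeckeCharacter.galConj c φ))⁻¹).IsUnramifiedAt v ∧
      ‖((ι.symm ((HeckeCharacter.galConj c φ *
          (HeckeCharacter.galConj c (HeckeCharacter.galConj c φ))⁻¹).valueAtUniformizer v) : PadicAlgCl p) :
        ℂ_[p]) - 1‖ =
      ‖((ι.symm ((φ * (HeckeCharacter.galConj c φ)⁻¹).valueAtUniformizer v) : PadicAlgCl p) :
        ℂ_[p]) - 1‖ := by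
    intro v hunr hle
    refine ⟨by rw [hinv]; exact hunr.inv', ?_⟩
    rw [hinv, HeckeCharacter.valueAtUniformizer_inv', map_inv₀, PadicComplex.coe_eq, map_inv₀,
      ← PadicComplex.coe_eq]
    exact norm_inv_sub_one_eq (norm_lt_one_of_sq_le hle hp1)
  obtain ⟨⟨S, hS, hS'⟩, ⟨v₀, hpv₀, hunr₀, heq₀⟩⟩ := h
  refine ⟨⟨S, hS, fun v hv ↦ ?_⟩, ?_⟩
  · obtain ⟨hpv, hunr, hle⟩ := hS' v hv
    obtain ⟨hunr', hnorm⟩ := key v hunr hle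
    exact ⟨hpv, hunr', by rw [hnorm]; exact hle⟩
  · obtain ⟨hunr', hnorm⟩ := key v₀ hunr₀ heq₀.le
    exact ⟨v₀, hpv₀, hunr', by rw [hnorm]; exact heq₀⟩

end LemmaXi

/-! ## H_V from H_Rig and the Deuring value clause -/

section Stub

open LemmaXi Summit.BirchSwinnertonDyer.Rank1Residual

variable (W : WeierstrassCurve ℚ) [W.IsElliptic] (p : ℕ) [hp : Fact p.Prime]

/-- **H_V ⟸ H_Rig + Deuring's value clause.** If the pinned characters of every CM curve `V` of the
frame's CM field are unique up to `cK` (the registered H_Rig `X12.O11.RamifiedCMPinnedCharacterStructureAtZp W p`)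
and for every such `V` and every `cK ≠ 1` there EXISTS a conjugation-equivariant Hecke character pinned to
`V` whose values at its unramified places are embedded generators (`ψ_D(ϖ_w) = σ'(α_w)`, `(α_w) = w` —
Deuring, Silverman ATAEC II Thm. 9.2 + Cor. 10.4.1 (a)), then the registered H_V
`X12.O11.RamifiedCMAcCharacterValuesAtZp W p` holds: the given pinned `ψ` and `φ ∈ {ψ, ψ∘cK}` lie in
`{ψ_D, ψ_D∘cK}`, and `LemmaXi.φac_values_of_deuringShape` / `φac_values_galConj` apply.
[cite: SilvermanATAEC1994, Ch. II Thm. 9.2 and Cor. 10.4.1 (a)] [cite: Landau1918Idealklassen, §1 Satz] -/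
theorem acCharacterValuesAtZp_of_pinnedStructure_of_deuringShape
    (hRig : X12.O11.RamifiedCMPinnedCharacterStructureAtZp W p)
    (hD : ∀ (K : Type) [Field K] [NumberField K] (𝔭 : HeightOneSpectrum (𝓞 K))
      (W' : WeierstrassCurve ℚ) [W'.IsElliptic] [W'.IsGloballyMinimal] (C : WeierstrassCurve.VariableChange ℚ),
      X12.O11.IsFrame W p K 𝔭 W' C →
      ∀ (V : WeierstrassCurve ℚ) [V.IsElliptic], V.HasCM →
        Rank1Residual.cmFieldDiscrOfJ V.j = Rank1Residual.cmFieldDiscrOfJ W.j →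
        ∀ (cK : K ≃ₐ[ℚ] K), cK ≠ 1 → ∃ (σ' : K →+* ℂ) (ψD : HeckeCharacter K),
          IsHeckeConjEquivariant cK ψD ∧ (∀ s : ℂ, 3 / 2 < s.re → heckeLFunction ψD s = V.LSeries s) ∧
          ∀ w : HeightOneSpectrum (𝓞 K), ψD.IsUnramifiedAt w →
            ∃ α : 𝓞 K, Ideal.span {α} = w.asIdeal ∧ ψD.valueAtUniformizer w = σ' (α : K)) :
    X12.O11.RamifiedCMAcCharacterValuesAtZp W p := by
  intro K _ _ 𝔭 W' _ _ C hF V _ hV hVW ι cK hc ψ _ _ hψL φ hφ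
  have hF' := hF
  obtain ⟨hCM, hram, hp5, hK, hdisc, hp𝔭, -⟩ := hF'
  have hd : NumberField.discr K = -(p : ℤ) := by
    rw [hdisc]; exact X12.cmFieldDiscrOfJ_eq_neg_of_dvd W hCM hp.out hp5 hram
  -- the Deuring character of `V` and the uniqueness of pinned characters
  obtain ⟨σ', ψD, heqD, hψDL, hvi⟩ := hD K 𝔭 W' C hF V hV hVW cK hc
  obtain ⟨ψR, -, -, -, huniq⟩ := hRig K 𝔭 W' C hF V hV hVW cK hc
  have h2 : Module.finrank ℚ K = 2 := hK.1
  -- `φ ∈ {ψD, ψD ∘ cK}`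
  have hcc : ∀ χ : HeckeCharacter K, HeckeCharacter.galConj cK (HeckeCharacter.galConj cK χ) = χ :=
    galConj_galConj_of_finrank_eq_two h2 cK
  have hψψD : ψ = ψD ∨ ψ = HeckeCharacter.galConj cK ψD := by
    rcases huniq ψ hψL with h1 | h1 <;> rcases huniq ψD hψDL with h3 | h3
    · exact Or.inl (h1.trans h3.symm)
    · exact Or.inr (by rw [h3, hcc]; exact h1)
    · exact Or.inr (by rw [h3]; exact h1)
    · exact Or.inl (h1.trans h3.symm)
  have hφD : φ = ψD ∨ φ = HeckeCharacter.galConj cK ψD := by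
    rcases hφ with h1 | h1
    · rw [h1]; exact hψψD
    · rcases hψψD with h3 | h3
      · exact Or.inr (by rw [h1, h3])
      · exact Or.inl (by rw [h1, h3, hcc])
  -- Deuring-shaped values of `ψD` off its (finite) set of ramified places
  have hvals : ∃ S : Set (HeightOneSpectrum (𝓞 K)), S.Finite ∧ ∀ w ∉ S,
      ψD.IsUnramifiedAt w ∧ ∃ α : 𝓞 K, Ideal.span {α} = w.asIdeal ∧ ψD.valueAtUniformizer w = σ' (α : K) := by
    have hfin : ∀ᶠ w : HeightOneSpectrum (𝓞 K) in Filter.cofinite, ψD.IsUnramifiedAt w :=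
      ψD.finite_ramifiedPlaces_iff.1 (HeckeCharacter.finite_ramifiedPlaces_holds ψD)
    rw [Filter.eventually_cofinite] at hfin
    refine ⟨_, hfin, fun w hw ↦ ?_⟩
    have hunr : ψD.IsUnramifiedAt w := by
      by_contra h
      exact hw h
    exact ⟨hunr, hvi w hunr⟩
  have hmain := φac_values_of_deuringShape hK hd hp5 hp𝔭 cK hc ι σ' heqD hvals
  rcases hφD with rfl | rfl
  · exact hmain
  · exact φac_values_galConj h2 cK ι hmain

end Stub

end Summit.BirchSwinnertonDyer.BirchSwinnertonDyer.Theorems.RamifiedSevenEllipticUnits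

end
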